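import Summits.CriticalPhenomena.PercolationContinuityZ3.Theorems.PercNearOneGluingNoHeavyLowerTailAntiBandDiagonal

/-!
# `NoHeavyLowerTail` (crux stmt-CriticalPhenomena-4575), lane prim-ineq-gen-4 (gen 34): the level-wise FKG bound for opposite-shifted pairs

Support file (`--supports stmt-CriticalPhenomena-4575`; memo `run/shared/lean/prim/prim-ineq-gen-4/FINDING-CYLINDER-g34.md` §7.2).
No definitions, no `sorry`, standard axioms.

For every level `k`, a left-shifted upper set `W` and a right-shifted family `V` on `Fin n`, the level correlation
`S_k = #(W∩V∩L_k) + #(c W ∩ c V ∩ L_k) − #(W ∩ c V ∩ L_k) − #(c W ∩ V ∩ L_k)` (`c X ∩ L_k = {x ∈ L_k | xᶜ ∈ X}`) satisfies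
`C(n,k) · S_k ≤ (#(W∩L_k) − #(c W ∩ L_k)) · (#(V∩L_k) − #(c V ∩ L_k))` (`level_correlation_le`): Daykin's inequality four times in the Young lattice `L(k, n−k)`
(the level with the prefix-count order), where `W∩L_k`, `c V∩L_k` are upper sets and `V∩L_k`, `c W∩L_k` lower sets.  At the middle level of an even cube the right
side vanishes — gen 34's diagonal theorem (`AntiBandDiagonal.card_midLevel_inter_le`); for `k < n/2` both factors are `≤ 0` (normalized matching), so this is an
UPPER bound on the level correlation, the exact combinatorial form of "within a level, oppositely shifted families are anti-correlated".
-/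

namespace Summit.CriticalPhenomena.PercolationContinuityZ3.Theorems.AntiBandLevelFKG

open Finset AntiBandDominance AntiBandDiagonal
open scoped FinsetFamily

variable {n : ℕ}

set_option maxHeartbeats 400000 in
/-- **Level-wise FKG bound.**  `W` a left-shifted upper set, `V` right-shifted (compressed along `({j},{i})`, `i < j`); on the level `L = {#s = m}`:
`#L · (#(W∩V∩L) + #(Wᶜˢ∩Vᶜˢ∩L) − #(W∩Vᶜˢ∩L) − #(Wᶜˢ∩V∩L)) ≤ (#(W∩L) − #(Wᶜˢ∩L)) · (#(V∩L) − #(Vᶜˢ∩L))` (in `ℤ`). [this work, memo §7.2] -/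
theorem level_correlation_le (m : ℕ) (W V : Finset (Finset (Fin n)))
    (hW : IsUpperSet (W : Set (Finset (Fin n)))) (hWsh : ∀ i j : Fin n, i < j → UV.IsCompressed ({i} : Finset (Fin n)) {j} W)
    (hVsh : ∀ i j : Fin n, i < j → UV.IsCompressed ({j} : Finset (Fin n)) {i} V) :
    (#((univ : Finset (Finset (Fin n))).filter fun s => #s = m) : ℤ) *
        ((#((W ∩ V).filter fun s => #s = m) : ℤ) + #((Wᶜˢ ∩ Vᶜˢ).filter fun s => #s = m)
          - #((W ∩ Vᶜˢ).filter fun s => #s = m) - #((Wᶜˢ ∩ V).filter fun s => #s = m))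
      ≤ ((#(W.filter fun s => #s = m) : ℤ) - #((Wᶜˢ).filter fun s => #s = m)) *
        ((#(V.filter fun s => #s = m) : ℤ) - #((Vᶜˢ).filter fun s => #s = m)) := by
  classical
  set L := univ.filter fun s : Finset (Fin n) => #s = m with hL
  have hmem : ∀ z : Finset (Fin n), z ∈ L ↔ #z = m := fun z => by rw [hL, mem_filter]; simp only [mem_univ, true_and]
  have hcc : ∀ s : Finset (Fin n), #sᶜ = n - #s := fun s => by rw [card_compl, Fintype.card_fin]
  have hcm : ∀ s : Finset (Fin n), #s = m → #sᶜ = n - m := fun s hs => by rw [hcc, hs]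
  -- prefix counts of complements
  have hcompl : ∀ (s : Finset (Fin n)) (k : ℕ), #(sᶜ.filter fun a : Fin n => (a : ℕ) < k) + #(s.filter fun a : Fin n => (a : ℕ) < k)
      = #((univ : Finset (Fin n)).filter fun a : Fin n => (a : ℕ) < k) := by
    intro s k
    rw [← card_union_of_disjoint (disjoint_filter_filter (compl_eq_univ_sdiff s ▸ sdiff_disjoint : Disjoint sᶜ s)), ← filter_union,
      compl_eq_univ_sdiff, sdiff_union_of_subset (subset_univ s)]
  set A := W.filter fun s => #s = m with hA
  set B := V.filter fun s => #s = m with hB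
  set C := L.filter fun s => sᶜ ∈ W with hC
  set D := L.filter fun s => sᶜ ∈ V with hD
  have hAL : A ⊆ L := fun s hs => by rw [hA, mem_filter] at hs; exact (hmem s).2 hs.2
  have hBL : B ⊆ L := fun s hs => by rw [hB, mem_filter] at hs; exact (hmem s).2 hs.2
  have hCL : C ⊆ L := filter_subset _ _
  have hDL : D ⊆ L := filter_subset _ _
  have hmA : ∀ s, s ∈ A ↔ s ∈ W ∧ #s = m := fun s => by rw [hA, mem_filter]
  have hmB : ∀ s, s ∈ B ↔ s ∈ V ∧ #s = m := fun s => by rw [hB, mem_filter]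
  have hmC : ∀ s, s ∈ C ↔ #s = m ∧ sᶜ ∈ W := fun s => by rw [hC, mem_filter, hmem]
  have hmD : ∀ s, s ∈ D ↔ #s = m ∧ sᶜ ∈ V := fun s => by rw [hD, mem_filter, hmem]
  -- the four prefix-upper families inside `L`: `A`, `D`, `L \\ B`, `L \\ C`
  have hupA : ∀ x ∈ A, ∀ z : Finset (Fin n), #z = m →
      (∀ k : ℕ, #(x.filter fun a : Fin n => (a : ℕ) < k) ≤ #(z.filter fun a : Fin n => (a : ℕ) < k)) → z ∈ A := by
    intro x hx z hz hle; rw [hA, mem_filter] at hx ⊢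
    exact ⟨mem_of_prefix_le W hW hWsh _ x z rfl hx.1 hle, hz⟩
  have hupD : ∀ x ∈ D, ∀ z : Finset (Fin n), #z = m →
      (∀ k : ℕ, #(x.filter fun a : Fin n => (a : ℕ) < k) ≤ #(z.filter fun a : Fin n => (a : ℕ) < k)) → z ∈ D := by
    intro x hx z hz hle; rw [hD, mem_filter, hmem] at hx ⊢
    refine ⟨hz, mem_of_prefix_ge_of_card_eq V hVsh _ xᶜ zᶜ rfl hx.2 (by rw [hcm z hz, hcm x hx.1]) fun k => ?_⟩
    have h1 := hcompl x k; have h2 := hcompl z k; have h3 := hle k; omega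
  have hupB : ∀ x ∈ L \ B, ∀ z : Finset (Fin n), #z = m →
      (∀ k : ℕ, #(x.filter fun a : Fin n => (a : ℕ) < k) ≤ #(z.filter fun a : Fin n => (a : ℕ) < k)) → z ∈ L \ B := by
    intro x hx z hz hle; rw [mem_sdiff, hmem, hB, mem_filter] at hx ⊢
    refine ⟨hz, fun hzB => hx.2 ⟨mem_of_prefix_ge_of_card_eq V hVsh _ z x rfl hzB.1 (by rw [hx.1, hz]) hle, hx.1⟩⟩
  have hupC : ∀ x ∈ L \ C, ∀ z : Finset (Fin n), #z = m →
      (∀ k : ℕ, #(x.filter fun a : Fin n => (a : ℕ) < k) ≤ #(z.filter fun a : Fin n => (a : ℕ) < k)) → z ∈ L \ C := by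
    intro x hx z hz hle; rw [mem_sdiff, hmem, hC, mem_filter, hmem] at hx ⊢
    refine ⟨hz, fun hzC => hx.2 ⟨hx.1, mem_of_prefix_le W hW hWsh _ zᶜ xᶜ rfl hzC.2 fun k => ?_⟩⟩
    have h1 := hcompl x k; have h2 := hcompl z k; have h3 := hle k; omega
  -- Daykin four times
  have h1 := card_mul_le_of_prefixUp_level m A D hAL hDL hupA hupD
  have h2 := card_mul_le_of_prefixUp_level m (L \ B) (L \ C) sdiff_subset sdiff_subset hupB hupC
  have h3 := card_mul_le_of_prefixUp_level m A (L \ B) hAL sdiff_subset hupA hupB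
  have h4 := card_mul_le_of_prefixUp_level m D (L \ C) hDL sdiff_subset hupD hupC
  rw [← hL] at h1 h2 h3 h4
  -- cardinality bookkeeping inside `L`
  have eLB : #(L \ B) = #L - #B := card_sdiff_of_subset hBL
  have eLC : #(L \ C) = #L - #C := card_sdiff_of_subset hCL
  have eBC : #((L \ B) ∩ (L \ C)) + #B + #C = #L + #(B ∩ C) := by
    have e1 : (L \ B) ∩ (L \ C) = L \ (B ∪ C) := by
      ext s; rw [mem_inter, mem_sdiff, mem_sdiff, mem_sdiff, mem_union]; tauto
    rw [e1, card_sdiff_of_subset (union_subset hBL hCL)]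
    have e2 := card_union_add_card_inter B C
    have e3 := card_le_card (union_subset hBL hCL); omega
  have eAB : #(A ∩ (L \ B)) + #(A ∩ B) = #A := by
    rw [← card_union_of_disjoint (disjoint_left.2 fun s h1 h2 => (mem_sdiff.1 (mem_inter.1 h1).2).2 (mem_inter.1 h2).2)]
    congr 1; ext s; rw [mem_union, mem_inter, mem_inter, mem_sdiff]
    constructor
    · rintro (⟨h, -⟩ | ⟨h, -⟩) <;> exact h
    · intro h; by_cases hb : s ∈ B; exacts [Or.inr ⟨h, hb⟩, Or.inl ⟨h, hAL h, hb⟩]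
  have eDC : #(D ∩ (L \ C)) + #(D ∩ C) = #D := by
    rw [← card_union_of_disjoint (disjoint_left.2 fun s h1 h2 => (mem_sdiff.1 (mem_inter.1 h1).2).2 (mem_inter.1 h2).2)]
    congr 1; ext s; rw [mem_union, mem_inter, mem_inter, mem_sdiff]
    constructor
    · rintro (⟨h, -⟩ | ⟨h, -⟩) <;> exact h
    · intro h; by_cases hc : s ∈ C; exacts [Or.inr ⟨h, hc⟩, Or.inl ⟨h, hDL h, hc⟩]
  -- identify the four sides and the two level families of complements
  have fAB : (W ∩ V).filter (fun s => #s = m) = A ∩ B := by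
    ext s; rw [mem_filter, mem_inter, mem_inter, hmA, hmB]; tauto
  have eAD : (W ∩ Vᶜˢ).filter (fun s => #s = m) = A ∩ D := by
    ext s; rw [mem_filter, mem_inter, mem_compls, mem_inter, hmA, hmD]; tauto
  have eCB : (Wᶜˢ ∩ V).filter (fun s => #s = m) = B ∩ C := by
    ext s; rw [mem_filter, mem_inter, mem_compls, mem_inter, hmB, hmC]; tauto
  have eCD' : (Wᶜˢ ∩ Vᶜˢ).filter (fun s => #s = m) = C ∩ D := by
    ext s; rw [mem_filter, mem_inter, mem_compls, mem_compls, mem_inter, hmC, hmD]; tauto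
  have eC : (Wᶜˢ).filter (fun s => #s = m) = C := by
    ext s; rw [mem_filter, mem_compls, hmC]; tauto
  have eD : (Vᶜˢ).filter (fun s => #s = m) = D := by
    ext s; rw [mem_filter, mem_compls, hmD]; tauto
  rw [fAB, eAD, eCB, eCD', eC, eD]
  have hBle : #B ≤ #L := card_le_card hBL
  have hCle : #C ≤ #L := card_le_card hCL
  -- the four clean correlations, in ℤ
  have I1 : (#A : ℤ) * #D ≤ #L * #(A ∩ D) := by exact_mod_cast h1
  have I2 : (#B : ℤ) * #C ≤ #L * #(B ∩ C) := by
    have h := h2; rw [eLB, eLC] at h; zify [hBle, hCle] at h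
    have e : (#((L \ B) ∩ (L \ C)) : ℤ) = #L + #(B ∩ C) - #B - #C := by have := eBC; zify at this; linarith
    rw [e] at h
    have h' : ((#L : ℤ) - #B) * (#L - #C) = #L * #L - #L * #C - #L * #B + #B * #C := by ring
    have h'' : (#L : ℤ) * (#L + #(B ∩ C) - #B - #C) = #L * #L + #L * #(B ∩ C) - #L * #B - #L * #C := by ring
    rw [h', h''] at h; linarith
  have I3 : (#L : ℤ) * #(A ∩ B) ≤ #A * #B := by
    have h := h3; rw [eLB] at h; zify [hBle] at h
    have e : (#(A ∩ (L \ B)) : ℤ) = #A - #(A ∩ B) := by have := eAB; zify at this; linarith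
    rw [e, mul_sub, mul_sub, mul_comm (#A : ℤ) #L] at h; linarith
  have I4 : (#L : ℤ) * #(C ∩ D) ≤ #D * #C := by
    rw [inter_comm D C] at eDC
    have h := h4; rw [eLC] at h; zify [hCle] at h
    have e : (#(D ∩ (L \ C)) : ℤ) = #D - #(C ∩ D) := by have := eDC; zify at this; linarith
    rw [e, mul_sub, mul_sub, mul_comm (#D : ℤ) #L] at h; linarith
  have key : (#L : ℤ) * (#(A ∩ B) + #(C ∩ D) - #(A ∩ D) - #(B ∩ C)) ≤ #A * #B + #D * #C - #A * #D - #B * #C := by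
    have e1 : (#L : ℤ) * (#(A ∩ B) + #(C ∩ D) - #(A ∩ D) - #(B ∩ C))
        = #L * #(A ∩ B) + #L * #(C ∩ D) - #L * #(A ∩ D) - #L * #(B ∩ C) := by ring
    rw [e1]; linarith
  have e2 : ((#A : ℤ) - #C) * (#B - #D) = #A * #B + #D * #C - #A * #D - #B * #C := by ring
  rw [e2]; exact key

end Summit.CriticalPhenomena.PercolationContinuityZ3.Theorems.AntiBandLevelFKG
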